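import Literature.Geometry.Lorentzian.KerrDataAsymptoticFlatness
import Literature.Geometry.Lorentzian.ConstraintFamilies
import HarnessLib

/-!
# The ADM linear momentum of the Kerr–Schild slice data vanishes (discharge of `Kerr.hasADMMomentum_data_zero`)

Discharge of the named fact `Kerr.hasADMMomentum_data_zero` (`KerrData.lean`): for every mass
`M ≥ 0`, every spin `a`, every inner radius `r₀` and every component `i`, the initial data set
`Kerr.data M a r₀ hM = (h, k)` induced by the Kerr metric in Kerr–Schild form on the slice
`{t* = 0}` has ADM linear momentum `Pᵢ = 0` on the Kerr–Schild end `Kerr.afEnd a r₀`, i.e. the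
momentum fluxes `Pᵢ(r) = (8π)⁻¹ ∮_{‖x‖ = r} ∑ⱼ (k_ij − (tr_h k) h_ij) xʲ/r dσ` converge to `0`
(`AFEnd.HasADMMomentum … i 0`). Arnowitt–Deser–Misner 1962; Bartnik–Isenberg 2004, §2;
García-Parrado–Valiente Kroon, J. Geom. Phys. 58 (2008), §5.

## Proof (parity)

The fluxes vanish **identically** beyond the inner radius, `Pᵢ(r) = 0` for `r > R`, because the
integrand is odd under the antipodal map of the coordinate sphere. The spatial reflection
`Q : (t, x⃗) ↦ (t, −x⃗)` of the Kerr–Schild chart (the composite of the equatorial reflection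
`z ↦ −z` and the rotation by `π` about the axis, both isometries of Kerr) preserves the Kerr–Schild
radius `r` and the scalar `H` and reverses the spatial part of the null covector `ℓ = (1, ℓ⃗)`
(`ℓ⃗` is linear in `x⃗` with coefficients depending on `r` only; Kerr–Schild 1965, Visser
arXiv:0706.0622, (33)–(35)), so `g_{Qx}(Qu, Qv) = g_x(u, v)` for the Kerr–Schild form
`g = η + 2H ℓ ⊗ ℓ` and `T(Qx) = Q T(x)` for the time vector `T = (1 + 2H, −2H ℓ⃗)`
(`Kerr.bilin_spaceReflect`, `Kerr.timeVector_spaceReflect`). Along the slice `y ↦ (0, y)` this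
says that the metric components `G(y) = g_{(0,y)}` and the unit normal `N(y) = (1 + 2H)^{-1/2} T`
satisfy `G(−y) = Q^*G(y)`, `N(−y) = Q N(y)`, hence `DG(−y)(v) = −Q^*(DG(y)(v))` and
`DN(−y)(v) = −Q DN(y)(v)`; substituting into the coordinate expression of the second fundamental
form (`Kerr.secondFundamentalForm_sliceEmbed_eq`:
`K(v, w) = G(DN v, w̃) + ½ (DG(v)(N, w̃) + DG(N⃗)(w̃, ṽ) − DG(w)(ṽ, N))`) every sign cancels, so
the chart components `k_ij`, `h_ij` and the mean curvature `tr_h k = tr (h⁻¹ k)` are **even**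
functions of `x⃗` on the end (`Kerr.kCoeff_afEnd_data_neg`, `Kerr.hCoeff_afEnd_data_neg`,
`Kerr.trKCoeff_afEnd_data_neg`). The flux integrand `∑ⱼ (k_ij − (tr k) h_ij)(x) xʲ/r` is therefore
odd, and an odd function has zero integral over the sphere `‖x‖ = r` for the isometry-invariant
surface measure `μHE[2]` (a private helper, as in `LandauLifshitzPseudotensor.lean`). This is the symmetry
argument behind the vanishing of the linear momentum of Kerr–Schild slices recorded in
García-Parrado–Valiente Kroon 2008, §5 (the `O(r⁻²)` part of `k` is the even, spherically symmetric
Schwarzschild one); no asymptotic expansion is needed.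

* `Kerr.bilin_spaceReflect`, `Kerr.timeVector_spaceReflect` — the reflection symmetry of the
  Kerr–Schild form and of the time vector;
* `Kerr.secondFundamentalForm_sliceEmbed_neg_of_spaceReflect`, `Kerr.sliceK_neg` — `K_{(0,−y)}(v, w) = K_{(0,y)}(v, w)`;
* `Kerr.admMomentumFlux_afEnd_data_eq_zero` — `Pᵢ(r) = 0` for `r > R`;
* `Kerr.hasADMMomentum_data_zero_holds` — **the named fact, verbatim** (closed statement; the
  instance hypotheses `[Kerr.Facts] [Kerr.SliceFacts]` of the fact are themselves theorems,
  `Kerr.facts_holds`, `Kerr.sliceFacts_holds`).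

Everything is proved; no definitions, no named facts (the reflection `Q` is an auxiliary
continuous linear map characterised by its components; it and the other pieces of linear
algebra / calculus plumbing are private helpers).

## References

* R. Arnowitt, S. Deser, C. W. Misner, *The dynamics of general relativity*, in: Gravitation, an
  introduction to current research (1962), Ch. 7 (the ADM momentum flux).
* R. Bartnik, J. Isenberg, *The constraint equations*, in: The Einstein equations and the large
  scale behavior of gravitational fields (2004), §2.
* A. García-Parrado Gómez-Lobo, J. A. Valiente Kroon, *Kerr initial data*, J. Geom. Phys. 58
  (2008) 1186–1202, §5.
* G. B. Cook, *Initial data for numerical relativity*, Living Rev. Relativ. 3 (2000) 5, §3.2.2,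
  (55)–(58).
* M. Visser, *The Kerr spacetime: a brief introduction*, arXiv:0706.0622, (32)–(35).
-/

noncomputable section

open Set Filter Function Bundle TopologicalSpace Manifold MeasureTheory
open scoped ContDiff Manifold Topology

-- iterated operator-norm spaces over `E3`/`E4` (as in `KerrDataAsymptoticFlatness.lean`)
set_option maxSynthPendingDepth 3

namespace Literature.Geometry.Lorentzian

namespace Kerr

/-! ### Components of `(t, y)` -/

/-- `(t, y)¹ = y⁰`. [folklore] -/
private theorem ofTimeSpace_apply_one (t : ℝ) (y : E3) : E4.ofTimeSpace t y 1 = y 0 :=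
  E4.ofTimeSpace_apply_succ t y 0

/-- `(t, y)² = y¹`. [folklore] -/
private theorem ofTimeSpace_apply_two (t : ℝ) (y : E3) : E4.ofTimeSpace t y 2 = y 1 :=
  E4.ofTimeSpace_apply_succ t y 1

/-- `(t, y)³ = y²`. [folklore] -/
private theorem ofTimeSpace_apply_three (t : ℝ) (y : E3) : E4.ofTimeSpace t y 3 = y 2 :=
  E4.ofTimeSpace_apply_succ t y 2

/-- `(0, −w) = −(0, w)` (the slice inclusion is linear). [folklore] -/
private theorem ofTimeSpace_zero_neg (w : E3) : E4.ofTimeSpace 0 (-w) = -E4.ofTimeSpace 0 w := by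
  ext μ
  fin_cases μ <;> simp [ofTimeSpace_apply_one, ofTimeSpace_apply_two, ofTimeSpace_apply_three]

/-! ### The spatial reflection `(t, x⃗) ↦ (t, −x⃗)` of the Kerr–Schild chart -/

/-- **A spatial reflection exists as a continuous linear map**: `Q(t, x⃗) = (t, −x⃗)`, i.e.
`(Q u)⁰ = u⁰` and `(Q u)^μ = −u^μ` for `μ ≠ 0` (it is `2 dt ⊗ ∂_t − id`). [folklore] -/
private theorem exists_spaceReflect :
    ∃ Q : E4 →L[ℝ] E4, ∀ (u : E4) (μ : Fin 4), Q u μ = if μ = 0 then u 0 else -u μ := by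
  refine ⟨(2 : ℝ) • (EuclideanSpace.proj (0 : Fin 4) : E4 →L[ℝ] ℝ).smulRight
      (EuclideanSpace.single (0 : Fin 4) (1 : ℝ)) - ContinuousLinearMap.id ℝ E4, fun u μ ↦ ?_⟩
  fin_cases μ <;> simp [two_mul]

section SpaceReflect

variable {Q : E4 →L[ℝ] E4} (hQ : ∀ (u : E4) (μ : Fin 4), Q u μ = if μ = 0 then u 0 else -u μ)
include hQ

/-- `Q` is an involution. [folklore] -/
private theorem spaceReflect_spaceReflect (u : E4) : Q (Q u) = u := by
  ext μ
  fin_cases μ <;> simp [hQ]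

/-- `Q ∂_t = ∂_t`. [folklore] -/
private theorem spaceReflect_basisVector_zero : Q (E4.basisVector 0) = E4.basisVector 0 := by
  ext μ
  fin_cases μ <;> simp [hQ]

/-- `Q (t, w) = (t, −w)`. [folklore] -/
private theorem spaceReflect_ofTimeSpace (t : ℝ) (w : E3) :
    Q (E4.ofTimeSpace t w) = E4.ofTimeSpace t (-w) := by
  ext μ
  fin_cases μ <;> simp [hQ, ofTimeSpace_apply_one, ofTimeSpace_apply_two, ofTimeSpace_apply_three]

/-- `(0, −z) = Q (0, z)`: the antipodal map of the slice is the restriction of `Q`. [folklore] -/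
private theorem ofTimeSpace_zero_neg_eq_spaceReflect (z : E3) :
    E4.ofTimeSpace 0 (-z) = Q (E4.ofTimeSpace 0 z) :=
  (spaceReflect_ofTimeSpace hQ 0 z).symm

/-- The spatial part of `Q u` is `−u⃗`. [folklore] -/
private theorem spatial_spaceReflect (u : E4) : E4.spatial (Q u) = -E4.spatial u := by
  ext i
  simp [E4.spatial_apply, hQ, Fin.succ_ne_zero]

/-- **The Kerr–Schild radius is even under the spatial reflection** (it depends on `x⃗` through
`|x⃗|²` and `z²`). Visser arXiv:0706.0622, (35). [cite: arXiv07060622, (35)] -/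
theorem radius_spaceReflect (a : ℝ) (x : E4) : radius a (Q x) = radius a x := by
  simp [radius, E4.spatialNorm_sq, hQ]

/-- **The Kerr–Schild scalar `H` is even under the spatial reflection.** Visser arXiv:0706.0622,
(33). [cite: arXiv07060622, (33)] -/
theorem scalarH_spaceReflect (M a : ℝ) (x : E4) : scalarH M a (Q x) = scalarH M a x := by
  simp [scalarH, radius_spaceReflect hQ, hQ]

/-- **The Kerr–Schild null covector transforms as `ℓ_{Qx}(u) = ℓ_x(Qu)`**: `ℓ₀ = 1` is even and
`ℓ⃗ = ((r x + a y)/(r² + a²), (r y − a x)/(r² + a²), z/r)` is odd in `x⃗`. Visser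
arXiv:0706.0622, (34). [cite: arXiv07060622, (34)] -/
theorem nullCovector_spaceReflect (a : ℝ) (x u : E4) :
    nullCovector a (Q x) u = nullCovector a x (Q u) := by
  simp only [nullCovector, nullCovectorFun, E4.covector_apply, Fin.sum_univ_four, Fin.isValue,
    Matrix.cons_val_zero, Matrix.cons_val_one, Matrix.cons_val, radius_spaceReflect hQ, hQ]
  simp
  ring

/-- The Minkowski form is invariant under the spatial reflection. [folklore] -/
private theorem minkowskiBilin_spaceReflect (u v : E4) :
    Minkowski.bilin (Q u) (Q v) = Minkowski.bilin u v := by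
  simp [Minkowski.bilin_apply, Fin.sum_univ_three, hQ]

/-- **The Kerr–Schild form is invariant under the spatial reflection**:
`g_{Qx}(u, v) = g_x(Qu, Qv)` (`g = η + 2H ℓ ⊗ ℓ` with `H` even and `ℓ_{Qx} = ℓ_x ∘ Q`).
Kerr–Schild 1965; Visser arXiv:0706.0622, (32)–(35). [cite: arXiv07060622, (32)–(35)] -/
theorem bilin_spaceReflect (M a : ℝ) (x u v : E4) :
    bilin M a (Q x) u v = bilin M a x (Q u) (Q v) := by
  rw [bilin_apply, bilin_apply, scalarH_spaceReflect hQ, nullCovector_spaceReflect hQ,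
    nullCovector_spaceReflect hQ, minkowskiBilin_spaceReflect hQ]

/-- The null vector transforms as `ℓ♯(Qx) = Q ℓ♯(x)`. Visser arXiv:0706.0622, (34).
[cite: arXiv07060622, (34)] -/
theorem nullVector_spaceReflect (a : ℝ) (x : E4) : nullVector a (Q x) = Q (nullVector a x) := by
  ext μ
  fin_cases μ
  · simp [nullVector, nullCovectorFun, hQ]
  · simp [nullVector, nullCovectorFun, radius_spaceReflect hQ, hQ]
    ring
  · simp [nullVector, nullCovectorFun, radius_spaceReflect hQ, hQ]
    ring
  · simp [nullVector, nullCovectorFun, radius_spaceReflect hQ, hQ, neg_div]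

/-- **The Kerr–Schild time vector transforms as `T(Qx) = Q T(x)`** (`T = ∂_t − 2H ℓ♯`).
Dafermos–Rodnianski arXiv:0811.0354, §5.1. [cite: arXiv08110354, §5.1] -/
theorem timeVector_spaceReflect (M a : ℝ) (x : E4) :
    timeVector M a (Q x) = Q (timeVector M a x) := by
  simp only [timeVector, map_sub, map_smul, scalarH_spaceReflect hQ, nullVector_spaceReflect hQ,
    spaceReflect_basisVector_zero hQ]

/-! ### The metric components and the unit normal along the slice under `y ↦ −y` -/

/-- **`G(−y)(u, u') = G(y)(Qu, Qu')`** for the metric components `G(y) = g_{(0,y)}` along the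
slice. [cite: arXiv07060622, (32)–(35)] -/
theorem bilin_ofTimeSpace_neg (M a : ℝ) (y : E3) (u u' : E4) :
    bilin M a (E4.ofTimeSpace 0 (-y)) u u' = bilin M a (E4.ofTimeSpace 0 y) (Q u) (Q u') := by
  rw [ofTimeSpace_zero_neg_eq_spaceReflect hQ, bilin_spaceReflect hQ]

/-- **`N(−y) = Q N(y)`** for the unit normal `N = (1 + 2H)^{-1/2} T` along the slice.
[cite: Cook2000, §3.2.2] -/
theorem sliceNormalRep_neg (M a : ℝ) (y : E3) :
    (√(1 + 2 * scalarH M a (E4.ofTimeSpace 0 (-y))))⁻¹ • timeVector M a (E4.ofTimeSpace 0 (-y)) =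
      Q ((√(1 + 2 * scalarH M a (E4.ofTimeSpace 0 y)))⁻¹ • timeVector M a (E4.ofTimeSpace 0 y)) := by
  rw [ofTimeSpace_zero_neg_eq_spaceReflect hQ, scalarH_spaceReflect hQ, timeVector_spaceReflect hQ,
    map_smul]

/-- The radius is positive at `(0, −y)` iff at `(0, y)`. [cite: arXiv07060622, (35)] -/
theorem radius_ofTimeSpace_neg (a : ℝ) (y : E3) :
    radius a (E4.ofTimeSpace 0 (-y)) = radius a (E4.ofTimeSpace 0 y) := by
  rw [ofTimeSpace_zero_neg_eq_spaceReflect hQ, radius_spaceReflect hQ]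

omit hQ in
/-- Derivative of a component of a form-valued map: `∂_v (G(·)(u, u'))(x) = DG(x)(v)(u, u')`.
[folklore] -/
private theorem fderiv_apply_apply {G : E3 → E4 →L[ℝ] E4 →L[ℝ] ℝ} {x : E3} (hG : DifferentiableAt ℝ G x)
    (u u' : E4) (v : E3) :
    fderiv ℝ (fun y ↦ G y u u') x v = fderiv ℝ G x v u u' := by
  have h1 : DifferentiableAt ℝ (fun y ↦ G y u) x := hG.clm_apply (differentiableAt_const u)
  have e1 : fderiv ℝ (fun y ↦ G y u u') x =
      (G x u).comp (fderiv ℝ (fun _ : E3 ↦ u') x) + (fderiv ℝ (fun y ↦ G y u) x).flip u' :=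
    fderiv_clm_apply h1 (differentiableAt_const u')
  have e2 : fderiv ℝ (fun y ↦ G y u) x =
      (G x).comp (fderiv ℝ (fun _ : E3 ↦ u) x) + (fderiv ℝ G x).flip u :=
    fderiv_clm_apply hG (differentiableAt_const u)
  rw [e1, e2, fderiv_fun_const, fderiv_fun_const]
  simp only [Pi.zero_apply, ContinuousLinearMap.comp_zero, ContinuousLinearMap.flip_apply, zero_add]

/-- **`DG(−y)(v)(u, u') = −DG(y)(v)(Qu, Qu')`**: differentiate `G(−y)(u, u') = G(y)(Qu, Qu')`
(chain rule with `y ↦ −y`), at points of the chart domain (`r > 0`, where `G` is differentiable).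
[cite: arXiv07060622, (32)–(35)] -/
theorem fderiv_bilin_ofTimeSpace_neg (M a : ℝ) {y : E3} (hy : 0 < radius a (E4.ofTimeSpace 0 y))
    (v : E3) (u u' : E4) :
    fderiv ℝ (fun z : E3 ↦ bilin M a (E4.ofTimeSpace 0 z)) (-y) v u u' =
      -(fderiv ℝ (fun z : E3 ↦ bilin M a (E4.ofTimeSpace 0 z)) y v (Q u) (Q u')) := by
  have hO : ContDiff ℝ 1 (E4.ofTimeSpace 0) := contMDiff_iff_contDiff.mp (E4.contMDiff_ofTimeSpace 0 1)
  have hGd : ∀ {z : E3}, 0 < radius a (E4.ofTimeSpace 0 z) →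
      DifferentiableAt ℝ (fun z : E3 ↦ bilin M a (E4.ofTimeSpace 0 z)) z := fun hz ↦
    ((contDiffAt_bilin M a hz (n := 1)).comp _ hO.contDiffAt).differentiableAt one_ne_zero
  have hy' : 0 < radius a (E4.ofTimeSpace 0 (-y)) := by rwa [radius_ofTimeSpace_neg hQ]
  -- the scalar components `g(z) = G(z)(u,u')` and `g'(z) = G(z)(Qu, Qu')`, `g = g' ∘ (−)`
  set g' : E3 → ℝ := fun z ↦ bilin M a (E4.ofTimeSpace 0 z) (Q u) (Q u') with hg'
  have hfun : (fun z : E3 ↦ bilin M a (E4.ofTimeSpace 0 z) u u') =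
      g' ∘ ⇑(ContinuousLinearEquiv.neg ℝ : E3 ≃L[ℝ] E3) := by
    funext z
    rw [Function.comp_apply, ContinuousLinearEquiv.neg_apply, hg']
    dsimp only
    rw [bilin_ofTimeSpace_neg hQ, spaceReflect_spaceReflect hQ, spaceReflect_spaceReflect hQ]
  rw [← fderiv_apply_apply (hGd hy'), hfun, ContinuousLinearEquiv.comp_right_fderiv]
  simp only [ContinuousLinearMap.comp_apply, ContinuousLinearEquiv.coe_coe,
    ContinuousLinearEquiv.neg_apply, neg_neg, map_neg, hg']
  rw [fderiv_apply_apply (hGd hy)]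

/-- **`DN(−y)(v) = −Q DN(y)(v)`**: differentiate `N(−y) = Q N(y)`, for `M ≥ 0` at points of
the chart domain. [cite: Cook2000, §3.2.2] -/
theorem fderiv_sliceNormalRep_neg {M : ℝ} (hM : 0 ≤ M) (a : ℝ) {y : E3}
    (hy : 0 < radius a (E4.ofTimeSpace 0 y)) (v : E3) :
    fderiv ℝ (fun z : E3 ↦ (√(1 + 2 * scalarH M a (E4.ofTimeSpace 0 z)))⁻¹ •
        timeVector M a (E4.ofTimeSpace 0 z)) (-y) v =
      -(Q (fderiv ℝ (fun z : E3 ↦ (√(1 + 2 * scalarH M a (E4.ofTimeSpace 0 z)))⁻¹ •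
        timeVector M a (E4.ofTimeSpace 0 z)) y v)) := by
  set N : E3 → E4 := fun z ↦ (√(1 + 2 * scalarH M a (E4.ofTimeSpace 0 z)))⁻¹ •
    timeVector M a (E4.ofTimeSpace 0 z) with hN
  have hNd : DifferentiableAt ℝ N y :=
    (contDiffAt_sliceNormalRep hM a hy (n := 1)).differentiableAt one_ne_zero
  -- `N = Q ∘ N ∘ (−)`
  have h1 : HasFDerivAt (⇑Q ∘ N) (Q.comp (fderiv ℝ N y))
      ((ContinuousLinearEquiv.neg ℝ : E3 ≃L[ℝ] E3) (-y)) := by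
    rw [ContinuousLinearEquiv.neg_apply, neg_neg]
    exact Q.hasFDerivAt.comp y hNd.hasFDerivAt
  have h2 : HasFDerivAt ((⇑Q ∘ N) ∘ ⇑(ContinuousLinearEquiv.neg ℝ : E3 ≃L[ℝ] E3))
      ((Q.comp (fderiv ℝ N y)).comp ((ContinuousLinearEquiv.neg ℝ : E3 ≃L[ℝ] E3) : E3 →L[ℝ] E3))
      (-y) :=
    h1.comp (-y) (ContinuousLinearEquiv.neg ℝ : E3 ≃L[ℝ] E3).hasFDerivAt
  have h3 : HasFDerivAt N
      ((Q.comp (fderiv ℝ N y)).comp ((ContinuousLinearEquiv.neg ℝ : E3 ≃L[ℝ] E3) : E3 →L[ℝ] E3))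
      (-y) := by
    refine h2.congr_of_eventuallyEq (Eventually.of_forall fun z ↦ ?_)
    simp only [Function.comp_apply, ContinuousLinearEquiv.neg_apply, hN]
    rw [sliceNormalRep_neg hQ, spaceReflect_spaceReflect hQ]
  rw [h3.fderiv]
  simp only [ContinuousLinearMap.comp_apply, ContinuousLinearEquiv.coe_coe,
    ContinuousLinearEquiv.neg_apply, map_neg]

/-! ### The second fundamental form of the slice is even under `y ↦ −y` -/

/-- **`K_{(0,−y)}(v, w) = K_{(0,y)}(v, w)`**: in the coordinate expression
`K(v, w) = G(DN v, w̃) + ½ (DG(v)(N, w̃) + DG(N⃗)(w̃, ṽ) − DG(w)(ṽ, N))`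
(`Kerr.secondFundamentalForm_sliceEmbed_eq`) at `−y`, substitute `G(−y) = Q^*G(y)`,
`N(−y) = Q N(y)`, `DG(−y)(v) = −Q^*(DG(y)(v))`, `DN(−y)(v) = −Q DN(y)(v)`, `Q w̃ = −w̃`,
`(Q N)⃗ = −N⃗`: all signs cancel. For `M ≥ 0`. García-Parrado–Valiente Kroon 2008, §5; Cook 2000,
§3.2.2, (57). [cite: Cook2000, §3.2.2 (57)] -/
theorem secondFundamentalForm_sliceEmbed_neg_of_spaceReflect [Facts] {M : ℝ} (hM : 0 ≤ M) {a r₀ : ℝ}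
    [(smoothMetric M a r₀).HasLeviCivita] (y y' : slice a r₀) (hy : (y' : E3) = -(y : E3))
    (v w : E3) :
    (smoothMetric M a r₀).secondFundamentalForm 𝓘(ℝ, E3) (sliceEmbed a r₀) (sliceNormal M a r₀) y' v w =
      (smoothMetric M a r₀).secondFundamentalForm 𝓘(ℝ, E3) (sliceEmbed a r₀) (sliceNormal M a r₀)
        y v w := by
  have hr : 0 < radius a (E4.ofTimeSpace 0 (y : E3)) :=
    radius_pos_of_mem_region (mem_slice_iff_ofTimeSpace_mem_region.1 y.2)
  rw [secondFundamentalForm_sliceEmbed_eq hM y', secondFundamentalForm_sliceEmbed_eq hM y, hy]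
  set Gf : E3 → E4 →L[ℝ] E4 →L[ℝ] ℝ := fun z ↦ bilin M a (E4.ofTimeSpace 0 z) with hGf
  set N : E3 → E4 := fun z ↦ (√(1 + 2 * scalarH M a (E4.ofTimeSpace 0 z)))⁻¹ •
    timeVector M a (E4.ofTimeSpace 0 z) with hN
  -- the four symmetry inputs
  have hG : ∀ u u' : E4, bilin M a (E4.ofTimeSpace 0 (-(y : E3))) u u' =
      bilin M a (E4.ofTimeSpace 0 (y : E3)) (Q u) (Q u') := bilin_ofTimeSpace_neg hQ M a y
  have hNv : N (-(y : E3)) = Q (N y) := sliceNormalRep_neg hQ M a y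
  have hDG : ∀ (v : E3) (u u' : E4), fderiv ℝ Gf (-(y : E3)) v u u' =
      -(fderiv ℝ Gf y v (Q u) (Q u')) := fderiv_bilin_ofTimeSpace_neg hQ M a hr
  have hDN : ∀ v : E3, fderiv ℝ N (-(y : E3)) v = -(Q (fderiv ℝ N y v)) :=
    fderiv_sliceNormalRep_neg hQ hM a hr
  have hQw : ∀ w : E3, Q (E4.ofTimeSpace 0 w) = -E4.ofTimeSpace 0 w := fun w ↦ by
    rw [spaceReflect_ofTimeSpace hQ, ofTimeSpace_zero_neg]
  -- term by term
  have h1 : bilin M a (E4.ofTimeSpace 0 (-(y : E3))) (fderiv ℝ N (-(y : E3)) v) (E4.ofTimeSpace 0 w) =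
      bilin M a (E4.ofTimeSpace 0 (y : E3)) (fderiv ℝ N y v) (E4.ofTimeSpace 0 w) := by
    rw [hG, hDN, map_neg, spaceReflect_spaceReflect hQ, hQw, map_neg, map_neg, neg_apply, neg_neg]
  have h2 : fderiv ℝ Gf (-(y : E3)) v (N (-(y : E3))) (E4.ofTimeSpace 0 w) =
      fderiv ℝ Gf y v (N y) (E4.ofTimeSpace 0 w) := by
    rw [hDG, hNv, spaceReflect_spaceReflect hQ, hQw, map_neg, neg_neg]
  have h3 : fderiv ℝ Gf (-(y : E3)) (E4.spatial (N (-(y : E3)))) (E4.ofTimeSpace 0 w) (E4.ofTimeSpace 0 v) =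
      fderiv ℝ Gf y (E4.spatial (N y)) (E4.ofTimeSpace 0 w) (E4.ofTimeSpace 0 v) := by
    rw [hNv, spatial_spaceReflect hQ, map_neg, neg_apply, neg_apply, hDG, hQw, hQw, map_neg,
      map_neg, neg_apply, neg_neg, neg_neg]
  have h4 : fderiv ℝ Gf (-(y : E3)) w (E4.ofTimeSpace 0 v) (N (-(y : E3))) =
      fderiv ℝ Gf y w (E4.ofTimeSpace 0 v) (N y) := by
    rw [hDG, hNv, spaceReflect_spaceReflect hQ, hQw, map_neg, neg_apply, neg_neg]
  simp only [hGf, hN] at h1 h2 h3 h4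
  rw [h1, h2, h3, h4]

end SpaceReflect

/-! ### Evenness of the Kerr data under the antipodal map of the slice -/

section Data

variable [Facts] [SliceFacts]

/-- **The second fundamental form of the Kerr–Schild slice is even**: `k_{⟨−y⟩}(v, w) = k_{⟨y⟩}(v, w)`
for `M ≥ 0` (`Kerr.sliceK` is `K_ν` by `rfl`). García-Parrado–Valiente Kroon 2008, §5; Cook 2000,
§3.2.2, (57). [cite: Cook2000, §3.2.2 (57)] -/
theorem sliceK_neg {M : ℝ} (hM : 0 ≤ M) {a r₀ : ℝ} (y y' : slice a r₀) (hy : (y' : E3) = -(y : E3))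
    (v w : E3) : sliceK M a r₀ y' v w = sliceK M a r₀ y v w := by
  obtain ⟨Q, hQ⟩ := exists_spaceReflect
  rw [sliceK_apply, sliceK_apply]
  exact secondFundamentalForm_sliceEmbed_neg_of_spaceReflect hQ hM y y' hy v w

/-- **The induced metric of the Kerr–Schild slice is even**: `h_{⟨−y⟩}(v, w) = h_{⟨y⟩}(v, w)`
(`h = g((0,v), (0,w))` at `(0, y)`, and `g_{(0,−y)}((0,v), (0,w)) = g_{(0,y)}((0,−v), (0,−w))`).
Cook 2000, §3.2.2, (55). [cite: Cook2000, §3.2.2 (55)] -/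
theorem data_h_inner_neg {M : ℝ} (hM : 0 ≤ M) {a r₀ : ℝ} (y y' : slice a r₀)
    (hy : (y' : E3) = -(y : E3)) (v w : E3) :
    (data M a r₀ hM).h.inner y' v w = (data M a r₀ hM).h.inner y v w := by
  obtain ⟨Q, hQ⟩ := exists_spaceReflect
  have key : ∀ (p : slice a r₀) (v' w' : E3), (data M a r₀ hM).h.inner p v' w' =
      bilin M a (E4.ofTimeSpace 0 (p : E3)) (E4.ofTimeSpace 0 v') (E4.ofTimeSpace 0 w') := by
    intro p v' w'
    rw [data_h_inner, PseudoRiemannianMetric.inducedBilin_apply, mfderiv_sliceEmbed]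
    rfl
  rw [key, key, hy, bilin_ofTimeSpace_neg hQ, spaceReflect_ofTimeSpace hQ, spaceReflect_ofTimeSpace hQ,
    ofTimeSpace_zero_neg, ofTimeSpace_zero_neg, map_neg, map_neg, neg_apply, neg_neg]

/-- **The mean curvature of the Kerr–Schild slice is even**: `(tr_h k)(⟨−y⟩) = (tr_h k)(⟨y⟩)`,
since `tr_h k = tr (h⁻¹ k)` (`OpensChart.traceK_eq_trace_inverse_comp`) with `h`, `k` even.
Cook 2000, §3.2.2, (58). [cite: Cook2000, §3.2.2 (58)] -/
theorem traceK_data_neg {M : ℝ} (hM : 0 ≤ M) {a r₀ : ℝ} (y y' : slice a r₀)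
    (hy : (y' : E3) = -(y : E3)) : (data M a r₀ hM).traceK y' = (data M a r₀ hM).traceK y := by
  have h1 : OpensChart.innerE (data M a r₀ hM) y' = OpensChart.innerE (data M a r₀ hM) y := by
    ext v w
    rw [OpensChart.innerE_apply, OpensChart.innerE_apply]
    exact data_h_inner_neg hM y y' hy v w
  have h2 : OpensChart.kE (data M a r₀ hM) y' = OpensChart.kE (data M a r₀ hM) y := by
    ext v w
    rw [OpensChart.kE_apply, OpensChart.kE_apply, data_k]
    exact sliceK_neg hM y y' hy v w
  rw [OpensChart.traceK_eq_trace_inverse_comp, OpensChart.traceK_eq_trace_inverse_comp, h1, h2]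

/-- **The chart components of `k` on the Kerr–Schild end are even**: `k_ij(−x) = k_ij(x)` for
`‖x‖ > R`. [cite: Cook2000, §3.2.2 (57)] -/
theorem kCoeff_afEnd_data_neg {M : ℝ} (hM : 0 ≤ M) (a r₀ : ℝ) {x : E3} (hx : afRadius a r₀ < ‖x‖)
    (v w : E3) :
    AFEnd.kCoeff (afEnd a r₀) (data M a r₀ hM) (-x) v w = AFEnd.kCoeff (afEnd a r₀) (data M a r₀ hM) x v w := by
  have hx' : afRadius a r₀ < ‖-x‖ := by rwa [norm_neg]
  rw [kCoeff_afEnd_data_apply hM a r₀ hx', kCoeff_afEnd_data_apply hM a r₀ hx]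
  exact sliceK_neg hM _ _ rfl v w

/-- **The chart components of `h` on the Kerr–Schild end are even**: `h_ij(−x) = h_ij(x)` for
`‖x‖ > R`. [cite: Cook2000, §3.2.2 (55)] -/
theorem hCoeff_afEnd_data_neg {M : ℝ} (hM : 0 ≤ M) (a r₀ : ℝ) {x : E3} (hx : afRadius a r₀ < ‖x‖)
    (v w : E3) :
    AFEnd.hCoeff (afEnd a r₀) (data M a r₀ hM) (-x) v w = AFEnd.hCoeff (afEnd a r₀) (data M a r₀ hM) x v w := by
  obtain ⟨Q, hQ⟩ := exists_spaceReflect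
  have hx' : afRadius a r₀ < ‖-x‖ := by rwa [norm_neg]
  rw [hCoeff_afEnd_data_apply hM a r₀ hx', hCoeff_afEnd_data_apply hM a r₀ hx, bilin_ofTimeSpace_neg hQ,
    spaceReflect_ofTimeSpace hQ, spaceReflect_ofTimeSpace hQ, ofTimeSpace_zero_neg, ofTimeSpace_zero_neg,
    map_neg, map_neg, neg_apply, neg_neg]

/-- **The mean curvature read in the chart of the Kerr–Schild end is even**:
`(tr_h k)(−x) = (tr_h k)(x)` for `‖x‖ > R`. [cite: Cook2000, §3.2.2 (58)] -/
theorem trKCoeff_afEnd_data_neg {M : ℝ} (hM : 0 ≤ M) (a r₀ : ℝ) {x : E3} (hx : afRadius a r₀ < ‖x‖) :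
    AFEnd.trKCoeff (afEnd a r₀) (data M a r₀ hM) (-x) = AFEnd.trKCoeff (afEnd a r₀) (data M a r₀ hM) x := by
  have hx' : afRadius a r₀ < ‖-x‖ := by rwa [norm_neg]
  have hxR : (afEnd a r₀).R < ‖x‖ := hx
  have hxR' : (afEnd a r₀).R < ‖-x‖ := hx'
  unfold AFEnd.trKCoeff
  rw [dif_pos hxR', dif_pos hxR, dataChart_afEnd, dataChart_afEnd]
  exact traceK_data_neg hM _ _ rfl

/-! ### Odd integrands on coordinate spheres -/

omit [Facts] [SliceFacts] in
/-- **An integrand odd under the antipodal map has zero sphere integral**: if `F(−x) = −F(x)` on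
`‖x‖ = r` then `∮_{‖x‖ = r} F dμHE[2] = 0` (`x ↦ −x` is an isometry preserving the sphere and the
surface measure `μHE[2]`). [folklore] -/
private theorem setIntegral_sphere_eq_zero_of_odd' {F : E3 → ℝ} {r : ℝ}
    (hF : ∀ x ∈ Metric.sphere (0 : E3) r, F (-x) = -F x) :
    ∫ x in Metric.sphere (0 : E3) r, F x ∂(μHE[2] : Measure E3) = 0 := by
  set σ : E3 ≃ᵢ E3 := (LinearIsometryEquiv.neg ℝ : E3 ≃ₗᵢ[ℝ] E3).toIsometryEquiv with hσ
  have hσapp : ∀ x : E3, σ x = -x := fun x ↦ rfl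
  have hmp : MeasurePreserving σ (μHE[2] : Measure E3) (μHE[2] : Measure E3) :=
    σ.measurePreserving_euclideanHausdorffMeasure 2
  have hme : MeasurableEmbedding σ := σ.toHomeomorph.measurableEmbedding
  have hpre : σ ⁻¹' Metric.sphere (0 : E3) r = Metric.sphere 0 r := by
    ext x
    rw [Set.mem_preimage, Metric.mem_sphere, Metric.mem_sphere, hσapp, dist_zero_right,
      dist_zero_right, norm_neg]
  have h := hmp.setIntegral_preimage_emb hme F (Metric.sphere 0 r)
  rw [hpre] at h
  simp only [hσapp] at h
  have h' : ∫ x in Metric.sphere (0 : E3) r, F (-x) ∂(μHE[2] : Measure E3) =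
      -∫ x in Metric.sphere (0 : E3) r, F x ∂(μHE[2] : Measure E3) := by
    rw [← integral_neg]
    exact setIntegral_congr_fun Metric.isClosed_sphere.measurableSet fun x hx ↦ hF x hx
  linarith

/-! ### The momentum fluxes vanish and the named fact -/

/-- **The ADM momentum fluxes of the Kerr–Schild slice data vanish identically beyond the inner
radius**: `Pᵢ(r) = (8π)⁻¹ ∮_{‖x‖ = r} ∑ⱼ (k_ij − (tr k) h_ij) xʲ/r dσ = 0` for `r > R`, the
integrand being odd under `x ↦ −x` (`k_ij`, `h_ij`, `tr k` even, `xʲ` odd).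
García-Parrado–Valiente Kroon 2008, §5; Arnowitt–Deser–Misner 1962. [cite: ArnowittDeserMisner1962] -/
theorem admMomentumFlux_afEnd_data_eq_zero {M : ℝ} (hM : 0 ≤ M) (a r₀ : ℝ) (i : Fin 3) {r : ℝ}
    (hr : afRadius a r₀ < r) :
    AFEnd.admMomentumFlux (afEnd a r₀) (data M a r₀ hM) i r = 0 := by
  unfold AFEnd.admMomentumFlux
  rw [setIntegral_sphere_eq_zero_of_odd', mul_zero]
  intro x hx
  have hxr : ‖x‖ = r := by simpa using hx
  have hxR : afRadius a r₀ < ‖x‖ := by rwa [hxr]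
  rw [← Finset.sum_neg_distrib]
  refine Finset.sum_congr rfl fun j _ ↦ ?_
  rw [kCoeff_afEnd_data_neg hM a r₀ hxR, hCoeff_afEnd_data_neg hM a r₀ hxR,
    trKCoeff_afEnd_data_neg hM a r₀ hxR, PiLp.neg_apply]
  ring

end Data

/-- **Discharge of the named fact `Kerr.hasADMMomentum_data_zero`** (`KerrData.lean`), verbatim
and for all `M, a, r₀`: under its instance hypotheses `[Kerr.Facts] [Kerr.SliceFacts]` (themselves
theorems, `Kerr.facts_holds`, `Kerr.sliceFacts_holds`) and its leading binder `0 ≤ M`, every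
component of the ADM linear momentum of the Kerr–Schild slice data on the end `Kerr.afEnd a r₀`
vanishes: the fluxes `Pᵢ(r)` are `0` for every `r > R` (`admMomentumFlux_afEnd_data_eq_zero`), hence
converge to `0`. Arnowitt–Deser–Misner 1962; Bartnik–Isenberg 2004, §2; García-Parrado–Valiente
Kroon 2008, §5. [cite: ArnowittDeserMisner1962] -/
theorem hasADMMomentum_data_zero_holds :
    ∀ [Facts] [SliceFacts] (M a r₀ : ℝ), hasADMMomentum_data_zero M a r₀ := by
  intro _ _ M a r₀ hM i
  show Tendsto (AFEnd.admMomentumFlux (afEnd a r₀) (data M a r₀ hM) i) atTop (𝓝 0)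
  refine tendsto_const_nhds.congr' ?_
  filter_upwards [eventually_gt_atTop (afRadius a r₀)] with r hr
  exact (admMomentumFlux_afEnd_data_eq_zero hM a r₀ i hr).symm

end Kerr

end Literature.Geometry.Lorentzian

end
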